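import Literature.Probability.Percolation.TriThetaExponentFromFacts
import Literature.Probability.Percolation.HalfPlaneTwoArmRadiiNearCritical
import HarnessLib

/-!
# `θ(p) = (p - 1/2)^{5/36 + o(1)}` from the two arm exponents, four-arm stability and three standard near-critical facts

Topic `Literature/Probability/Percolation`; family `crit-perc`, statement **crit-perc.S16**
(`Literature.Probability.Percolation.triTheta_exponent`: S. Smirnov, W. Werner, *Math. Res. Lett.* 8 (2001), Thm. 1 (i)).
Proofs only. The state of the reduction of `triTheta_exponent` along W. Werner's Lecture 6
(PCMI 2009) after the two half-plane two-arm estimates have been proved in the tree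
(`Nolin2008_halfPlane_twoArm_holds`, `HalfPlaneTwoArmRadii.lean`; `Werner2009_halfPlane_twoArm_holds`,
`HalfPlaneTwoArmRadiiNearCritical.lean` — Kesten's inner separation in the U-shaped half-annulus):

`triTheta_exponent` follows from
* the two critical arm exponents `oneArm_exponent` (`5/48`) and `fourArm_exponent` (`5/4`);
* (B) `Werner2009_lemma63` (four-arm stability below `L(p)`);
* the three standard near-critical estimates `Werner2009_fourArm_quasiMult`,
  `Werner2009_fourArm_lowerBound`, `Werner2009_pivotal_lowerBound`.

## References

* S. Smirnov, W. Werner, Critical exponents for two-dimensional percolation, *Math. Res. Lett.*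
  8 (2001), Thm. 1 (i) [SmirnovWernerMRL2001].
* W. Werner, *Lectures on two-dimensional critical percolation*, IAS/Park City Math. Ser. 16
  (2009), Lecture 6 [WernerPCMI2009].
* P. Nolin, Near-critical percolation in two dimensions, *Electron. J. Probab.* 13 (2008),
  Thm. 24 (i) [Nolin2008].
-/

noncomputable section

namespace Literature.Probability.Percolation

/-- **`θ(p) = (p - 1/2)^{5/36 + o(1)}` (Smirnov–Werner 2001, Thm. 1 (i)) from the two arm exponents,
the four-arm stability (B) and three standard near-critical facts** (`triTheta_exponent_of_facts`
with the half-plane two-arm estimates `Nolin2008_halfPlane_twoArm_holds` and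
`Werner2009_halfPlane_twoArm_holds` supplied by the tree). [cite: SmirnovWernerMRL2001, Thm. 1 (i)] [cite: WernerPCMI2009, Lecture 6, Thm. (5/36) ("End of the proof of the theorem")] -/
theorem triTheta_exponent_of_facts6 (h₁ : oneArm_exponent) (h₄ : fourArm_exponent)
    (hB : Werner2009_lemma63) (hQM : Werner2009_fourArm_quasiMult)
    (hLB : Werner2009_fourArm_lowerBound) (hP : Werner2009_pivotal_lowerBound) :
    triTheta_exponent :=
  triTheta_exponent_of_facts h₁ h₄ hB hQM hLB Nolin2008_halfPlane_twoArm_holds Werner2009_halfPlane_twoArm_holds hP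

end Literature.Probability.Percolation
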